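import Summits.CriticalPhenomena.PercolationContinuityZ3.Theorems.PercNearOneGluingNoHeavyPcintBSMZ9Cert
import HarnessLib

/-!
# PCINT lane, PHASE 5 (block-renewal second moment): kernel check 2/2 of the certificate inequalities for `ℤ^9`

Cell `prim-pcint`, seat `prim-pcint-1` (gen 14); memo `run/shared/lean/prim/pcint/T-FIBRE-ROUTE.md` §PHASE 5.
Instance `d = 9 = 6 + 3` (`k = 6` time axes, `t = 3` transverse axes), `β = 1/10` (`s = 4β = 2/5`),
horizon `N = 150`, cell `p = 962/10^4`. `certLHSz y ≤ φ y · (P^4 k DW² DG)`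
at orbit representatives `y` of `[-2,2]^3` (integer arithmetic; shared-key counts by `BSM.S3`).
-/

namespace Summit.CriticalPhenomena.PercolationContinuityZ3.Theorems.Pcint.BSM.Z9

open Summit.CriticalPhenomena.PercolationContinuityZ3.Theorems.Pcint.BSM

set_option maxHeartbeats 0 in
set_option maxRecDepth 65536 in
/-- The certificate inequalities on the offsets `((reps3.drop 5).take 1)`. -/
theorem hrep_6 : ∀ y ∈ ((reps3.drop 5).take 1), certLHSz pe3 (S3 pc3 6) W 6 10000 962 4 V0n V1n y * ((1 : ℕ) : ℤ) ≤ (Φn y : ℤ) * ((962 ^ 4 * 6 * 48000 ^ 2 * (1000000000000 * 1) : ℕ) : ℤ) := by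
  decide +kernel

set_option maxHeartbeats 0 in
set_option maxRecDepth 65536 in
/-- The certificate inequalities on the offsets `((reps3.drop 6).take 1)`. -/
theorem hrep_7 : ∀ y ∈ ((reps3.drop 6).take 1), certLHSz pe3 (S3 pc3 6) W 6 10000 962 4 V0n V1n y * ((1 : ℕ) : ℤ) ≤ (Φn y : ℤ) * ((962 ^ 4 * 6 * 48000 ^ 2 * (1000000000000 * 1) : ℕ) : ℤ) := by
  decide +kernel

set_option maxHeartbeats 0 in
set_option maxRecDepth 65536 in
/-- The certificate inequalities on the offsets `((reps3.drop 7).take 1)`. -/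
theorem hrep_8 : ∀ y ∈ ((reps3.drop 7).take 1), certLHSz pe3 (S3 pc3 6) W 6 10000 962 4 V0n V1n y * ((1 : ℕ) : ℤ) ≤ (Φn y : ℤ) * ((962 ^ 4 * 6 * 48000 ^ 2 * (1000000000000 * 1) : ℕ) : ℤ) := by
  decide +kernel

set_option maxHeartbeats 0 in
set_option maxRecDepth 65536 in
/-- The certificate inequalities on the offsets `((reps3.drop 8).take 1)`. -/
theorem hrep_9 : ∀ y ∈ ((reps3.drop 8).take 1), certLHSz pe3 (S3 pc3 6) W 6 10000 962 4 V0n V1n y * ((1 : ℕ) : ℤ) ≤ (Φn y : ℤ) * ((962 ^ 4 * 6 * 48000 ^ 2 * (1000000000000 * 1) : ℕ) : ℤ) := by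
  decide +kernel

set_option maxHeartbeats 0 in
set_option maxRecDepth 65536 in
/-- The certificate inequalities on the offsets `(reps3.drop 9)`. -/
theorem hrep_10 : ∀ y ∈ (reps3.drop 9), certLHSz pe3 (S3 pc3 6) W 6 10000 962 4 V0n V1n y * ((1 : ℕ) : ℤ) ≤ (Φn y : ℤ) * ((962 ^ 4 * 6 * 48000 ^ 2 * (1000000000000 * 1) : ℕ) : ℤ) := by
  decide +kernel

end Summit.CriticalPhenomena.PercolationContinuityZ3.Theorems.Pcint.BSM.Z9
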